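import Literature.AlgebraicGeometry.Resolution.Lipman1969StatementBOfPrincipalization
import Literature.AlgebraicGeometry.Resolution.PrincipalizationCodimTwoReduction
import Literature.AlgebraicGeometry.Resolution.ResolutionDominatedByBlowup
import HarnessLib

/-!
# Lipman 1969, proof of Proposition (1.2), statement B): what is left is the principalization of ideal
# sheaves with FINITE cosupport (closed points) on the regular surface — the sharpest hypothesis of record

Topic: `Literature/AlgebraicGeometry/Resolution`. PROVED, fact-free, definition-free (hand
leafhand-res-homologicalconduct-16 g2 of the cell decomp-res; AI-written bookkeeping over tree theorems,
weaker than expert review).  Assembles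
* `Lipman1969_1_2_B_of_principalization` (`Lipman1969StatementBOfPrincipalization.lean`: B) = Zariski's
  Theorem (26.1) special case ⟸ principalization of non-zero ideal sheaves on the resolution `X` — Stacks 081T +
  universal property of blowing up),
* `principalization_of_codimTwo` (`PrincipalizationCodimTwoReduction.lean`: the divisorial part is an effective
  Cartier divisor, Cossart–Piltant 2008 proof of Prop. 4.2, so only cosupports of codimension `≥ 2` matter),
* the dimension count: the source `X` of a resolution of the spectrum of a two-dimensional Noetherian domain is a
  Noetherian scheme of dimension `≤ 2` (`IsBirational.topologicalKrullDim_le_of_isNoetherian`), in which a closed set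
  of points of codimension `> 1` is a FINITE set of CLOSED points (the argument of `ResolutionDominatedByBlowup.lean`,
  §«A closed set of points of codimension ≥ dim X», re-run here since it is private there),
into

* `Lipman1969_1_2_B_of_principalization_finite` — **`Lipman1969_1_2_B` follows from: for every resolution
  `f : X → Spec R` of a two-dimensional normal Noetherian local domain and every non-zero ideal sheaf `J` on `X`
  whose cosupport is a finite set of closed points of codimension `≥ 2`, some resolution `j : Z → X` makes `J·𝒪_Z`
  an effective Cartier divisor** — i.e. from the classical principalization of finite-colength ideals of regular
  surfaces by point blow-ups (Zariski; Lipman (26.2); Kollár 2007 Thm. 1.74), and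
* (private plumbing) `IsResolution.finite_support_of_one_lt_coheight` — the finiteness statement used.

With hand 12's `Lipman1969_1_2_of_B` (Summits side) the W3 print `Lipman1969_1_2` of crux `NoZenoR` rests on that one
classical statement.  Not here: the point blow-ups and Zariski's termination (tree ingredients:
`BlowupClosedPointRegularSurface`, `BlowupStalkQuadraticTransform`, `IsRegularCentreBlowupSeq.isResolution`,
`QuadraticSequencePrincipalGenerator`).  No summit statement is proved.

## References
* J. Lipman, Publ. Math. IHÉS 36 (1969): proof of Prop. (1.2), statement B) (p. 200); Theorems (26.1), (26.2)
  (p. 274). [Lipman1969]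
* V. Cossart, O. Piltant, J. Algebra 320 (2008), proof of Prop. 4.2. [CossartPiltant2008]
* J. Kollár, *Lectures on Resolution of Singularities* (2007), Thm. 1.74, Rem. 1.78. [Kollar2007]
-/

noncomputable section

open CategoryTheory CategoryTheory.Limits AlgebraicGeometry TopologicalSpace

universe u

namespace Literature.AlgebraicGeometry.Resolution

open Scheme.IdealSheafData

/-! ## A closed set of points of codimension `≥ dim X` is a finite set of closed points
(re-run of the private plumbing of `ResolutionDominatedByBlowup.lean`) -/

section Finite

variable {X : Scheme.{u}}

/-- In a scheme of dimension `≤ n`, a closed subset all of whose points have codimension `≥ n` has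
dimension `≤ 0` (`height x + coheight x ≤ dim X ≤ n` and `coheight x ≥ n` force `height x = 0`).
[folklore] -/
private theorem topologicalKrullDim_le_zero_of_le_coheight' {n : ℕ} (hdim : topologicalKrullDim X ≤ n)
    {Z : Set X} (hZ : IsClosed Z) (hco : ∀ x ∈ Z, (n : ℕ∞) ≤ Order.coheight x) :
    topologicalKrullDim Z ≤ 0 := by
  have h := topologicalKrullDim_le_of_forall_height_le hZ 0 fun x hx => by
    have h2 : Order.height x + Order.coheight x ≤ n := by
      have := (coe_height_add_coheight_le_topologicalKrullDim x).trans hdim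
      exact_mod_cast this
    have hc : Order.coheight x ≤ n := le_trans le_add_self h2
    obtain ⟨c, hc'⟩ := ENat.ne_top_iff_exists.mp (ne_top_of_le_ne_top (ENat.coe_ne_top n) hc)
    have hh : Order.height x ≠ ⊤ := by
      intro h
      rw [h, top_add, top_le_iff] at h2
      exact ENat.coe_ne_top n h2
    obtain ⟨a, ha'⟩ := ENat.ne_top_iff_exists.mp hh
    have h1 : (n : ℕ∞) ≤ Order.coheight x := hco x hx
    rw [← hc', ← ha'] at h2
    rw [← hc'] at h1
    rw [← ha']
    have h1' : n ≤ c := by exact_mod_cast h1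
    have h2' : a + c ≤ n := by exact_mod_cast h2
    exact_mod_cast (show a ≤ 0 by omega)
  exact_mod_cast h

/-- In a Noetherian scheme of dimension `≤ 2`, a closed subset of points of codimension `> 1` is a finite set
of closed points. [folklore] -/
private theorem finite_and_isClosed_singleton_of_one_lt_coheight' [NoetherianSpace X]
    (hdim : topologicalKrullDim X ≤ 2) {Z : Set X} (hZ : IsClosed Z)
    (hco : ∀ x ∈ Z, 1 < Order.coheight x) :
    Z.Finite ∧ ∀ x ∈ Z, IsClosed ({x} : Set X) := by
  have h0 := topologicalKrullDim_le_zero_of_le_coheight' (n := 2) hdim hZ fun x hx =>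
    Order.add_one_le_of_lt (hco x hx)
  exact ⟨set_finite_of_topologicalKrullDim_le_zero Z h0,
    fun x hx => Literature.Topology.Set.isClosed_singleton_of_topologicalKrullDim_le_zero hZ h0 hx⟩

end Finite

/-- **On a resolution of the spectrum of a Noetherian domain of dimension `≤ 2`, an ideal sheaf whose cosupport
has codimension `≥ 2` has FINITE cosupport consisting of CLOSED points.**  (`X` is Noetherian of dimension
`≤ dim R ≤ 2`, being proper and birational over `Spec R`.) [folklore] -/
private theorem IsResolution.finite_support_of_one_lt_coheight {R : Type u} [CommRing R] [IsNoetherianRing R]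
    [IsDomain R] (hR : ringKrullDim R ≤ 2) {X : Scheme.{u}} {f : X ⟶ Spec (.of R)} (hf : IsResolution f)
    (J : X.IdealSheafData) (hco : ∀ x ∈ J.support, 1 < Order.coheight x) :
    (J.support : Set X).Finite ∧ ∀ x ∈ J.support, IsClosed ({x} : Set X) := by
  haveI : IsProper f := hf.isProper
  haveI : IsNoetherian X := by
    haveI : IsLocallyNoetherian X := LocallyOfFiniteType.isLocallyNoetherian f
    haveI : CompactSpace X := QuasiCompact.compactSpace_of_compactSpace f
    exact {}
  have hdimX : topologicalKrullDim X ≤ 2 := by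
    refine hf.isBirational.topologicalKrullDim_le_of_isNoetherian.trans ?_
    change topologicalKrullDim (PrimeSpectrum R) ≤ 2
    rw [PrimeSpectrum.topologicalKrullDim_eq_ringKrullDim]
    exact hR
  exact finite_and_isClosed_singleton_of_one_lt_coheight' hdimX J.support.isClosed hco

/-- **Lipman 1969, statement B) of the proof of Proposition (1.2), from the principalization of ideal sheaves
with FINITE cosupport on regular surfaces.**  If for every resolution `f : X → Spec R` of a two-dimensional
normal Noetherian local domain and every non-zero ideal sheaf `J` on `X` whose cosupport is a finite set of
closed points of codimension `≥ 2` there is a resolution `j : Z → X` with `J·𝒪_Z` an effective Cartier divisor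
(Zariski; Kollár 2007 Thm. 1.74 / Rem. 1.78 — hypothesis `hfin`), then `Lipman1969_1_2_B` holds: the
divisorial part of an arbitrary ideal sheaf is already invertible (`principalization_of_codimTwo`), the rest
has finite closed cosupport (`IsResolution.finite_support_of_one_lt_coheight`), and B) follows by
`Lipman1969_1_2_B_of_principalization`.
[cite: Lipman1969, Proposition (1.2), proof, statement B) (p. 200); Theorems (26.1), (26.2) (p. 274)]
[cite: CossartPiltant2008, proof of Prop. 4.2 (p. 7)] [cite: Kollar2007, Thm. 1.74 and Rem. 1.78] -/
theorem Lipman1969_1_2_B_of_principalization_finite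
    (hfin : ∀ (R : Type u) [CommRing R] [IsNoetherianRing R] [IsLocalRing R] [IsDomain R]
      [IsIntegrallyClosed R], ringKrullDim R = 2 →
      ∀ (X : Scheme.{u}) (f : X ⟶ Spec (.of R)), IsResolution f →
      ∀ J : X.IdealSheafData, J ≠ ⊥ → (J.support : Set X).Finite →
        (∀ x ∈ J.support, IsClosed ({x} : Set X)) → (∀ x ∈ J.support, 1 < Order.coheight x) →
        ∃ (Z : Scheme.{u}) (j : Z ⟶ X), IsResolution j ∧ IsEffectiveCartier (J.comap j)) :
    Lipman1969_1_2_B.{u} := by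
  refine Lipman1969_1_2_B_of_principalization fun R _ _ _ _ _ hR X f hf K hK => ?_
  haveI : IsProper f := hf.isProper
  haveI : IsIntegral X := hf.isIntegral_source
  haveI : IsNoetherian X := by
    haveI : IsLocallyNoetherian X := LocallyOfFiniteType.isLocallyNoetherian f
    haveI : CompactSpace X := QuasiCompact.compactSpace_of_compactSpace f
    exact {}
  refine principalization_of_codimTwo hf.isRegular (fun J hJ0 hco => ?_) K hK
  obtain ⟨hJfin, hJcl⟩ := hf.finite_support_of_one_lt_coheight hR.le J hco
  exact hfin R hR X f hf J hJ0 hJfin hJcl hco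

end Literature.AlgebraicGeometry.Resolution

end
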